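import Summits.QuantumFields.YangMills.Theorems.IR.BlockedActivityCalibrationMesh
import Summits.QuantumFields.YangMills.Theorems.IR.BlockedActivityKPDecay
import HarnessLib

/-!
# Crux `IR` (stmt-QuantumFields-19354), lane B «strong coupling AFTER BLOCKING»: the DISTANCE-SENSITIVE reduction — the hand-over radius of the
# activity axis becomes the Kotecký–Preiss radius, with a logarithmic window law (owner R118 (3): `r_C`, `w(ε)`)

Helper module for item `stmt-QuantumFields-19354` (`--supports`; it closes nothing), lane `ym-19354-onsetsc-p2` (g2).

THE POINT.  The lane's reductions so far (`univShellCond_of_blockedActivityW`, Dobrushin radius `radius ε ≈ ε·10⁻⁸⁵·⁷`;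
`univShellCond_of_blockedActivityW_sharp`, `radiusKP ε = ε∕(13448 e²)`) compare the centre expectation under each exterior datum with the
FREE reference value, so every cell factor is charged and the activity radius must shrink with the accuracy `ε` of the onset format:
THE NUMBER's weak-side target was `a⋆ = radiusKP(1∕3552) ≈ 2.85·10⁻⁹` at window `n = 1`.  The abstract decay theorem
`KP.norm_pertExpect_sub_pertExpect_le_of_eqOn` (`Theorems/IR/BlockedActivityKPDecay`, parts 1–3) compares the two data WITH EACH OTHER:
their cell factors differ only on cells adjacent to the outside of the `n`-window (`local_g`), i.e. at cell-sup-norm `≥ 2n`, and every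
`CellAdj`-connected cell set from the centre's neighbours to there has `≥ 2n` cells (`two_mul_le_card_of_connected`, discrete intermediate
values of the sup-norm along a chain of adjacent cells), so
  `|E_σ f − E_σ' f| ≤ 664 · e^{2+τ} · e^{−τ(2n+1)}`   whenever   `e^{1+τ} · a · 83² ≤ 1∕2`
(`Δ' = 82 = Δ + 1`, `Δ = 81` sup-neighbours, `B = 1`, `m = 2n`; `BlockedRepOnLoc.abs_integral_sub_integral_le_decay`).  The activity radius is
now the plain KP radius `radiusDecay τ = 1 ∕ (2 e^{1+τ} 83²)` — INDEPENDENT of `ε` — and the accuracy is bought by the window: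
`decayBound τ n = 664 e^{2+τ} e^{−τ(2n+1)} ≤ ε` iff `n ≥ (log (664∕ε) + 2) ∕ (2τ)` (for `τ = 1`: `n ≥ ½ log(1∕ε) + 4.25`).

LOCALITY IS LOAD-BEARING.  The relativised structure `BlockedRepOn` (p532761) kept the smallness and the representation but NOT the finite
range of the exterior dependence (`BlockedRep.local_g`, p527934); the distance-sensitive bound needs it.  Hence the LOCAL W-currency:
* `BlockedRepOnLoc ρ β w Y a S` = `BlockedRepOn` + `local_g`; `BlockedActivityClassWLoc`, `BlockedActivityTypWLoc`, `BlockedActivityTypWLocAll`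
  (W ∕ W|Typ ∕ every-centre, as in `Theorems/IR/BlockedActivityW`); forgetful maps to the W-classes of record and transfers FROM the σ-uniform
  class `BlockedActivityClass` (which has `local_g`) — so the strong-coupling calibrations (`blockedActivityClass_of_mesh_threshold`, p541588)
  inhabit the local classes at every mesh: `blockedActivityClassWLoc_of_mesh_threshold`.
* §3 **`univShellCond_of_blockedActivityWLoc_decay`**: `BlockedActivityClassWLoc ρ β b n a → 0 ≤ τ → e^{1+τ} a 83² ≤ 1∕2 →
  decayBound τ n ≤ ε → UnivShellCond ρ β b n ε`; **`clauseI_of_blockedActivityTypWLoc_decay`** (W|Typ ⇒ `FixedMesh.ClauseI`),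
  `clauseIAll_of_blockedActivityTypWLocAll_decay`.
* §4 THE NUMBERS (owner R118 (3) ask): `radiusDecay τ := 1 ∕ (2 e^{1+τ} 83²)`, `decayBound τ n := 664 e^{2+τ} e^{−τ(2n+1)}`;
  certified `radiusDecay_one_bounds : 1∕101810 < radiusDecay 1 < 1∕101800` (`r_C ≈ 9.82·10⁻⁶` per cell);
  `decayBound_one_twelve_admissible : decayBound 1 12 · shellCount 12 ≤ 3∕4` (window `n = 12` is ADMISSIBLE for the onset formats at
  `τ = 1`: `664 e³ e^{−25} · (51⁴ − 49⁴) ≈ 0.185`); **`univShellCond_twelve_of_blockedActivityWLoc`**: `BlockedActivityClassWLoc ρ β b 12 a →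
  a ≤ radiusDecay 1 → UnivShellCond ρ β b 12 (decayBound 1 12)`.  Window law (docstring number): `w(ε) = ⌈½ ln(1∕ε) + 4.25⌉` at `τ = 1`.
  So THE NUMBER's weak-side per-cell target moves from `a⋆ = radiusKP(1∕3552) ∈ (2.81, 2.88)·10⁻⁹` at `n = 1` to
  `r_C = radiusDecay 1 ∈ (9.822, 9.824)·10⁻⁶` at `n = 12` — a factor `≈ 3.4·10³`, and the statement now has the textbook shape «per-cell
  activity inside the KP ball, accuracy from the window».

HONEST FRAMING: reductions and constants among OPEN statements of a CONDITIONAL chain; the local W-classes are inhabited only by the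
strong-coupling calibrations (`|β| · b⁴ ≲ a`); nothing asserts weak-coupling mixing, a gap or Clay.
No `sorry`; axioms ⊆ {propext, Classical.choice, Quot.sound}; no instances, no notation.
Refs: KoteckyPreiss1986 (4)–(5); FriedliVelenik2017 §5.7; DobrushinShlosman1985 (the window format); owner rulings R103, R117, R118.
-/

set_option autoImplicit false

noncomputable section

open MeasureTheory ProbabilityTheory Finset
open Literature.MathematicalPhysics.QuantumFieldTheory Literature.MathematicalPhysics.QuantumLattice
open Literature.Probability.LatticeModels (IsLocalPerturbation IsLocalObservable pertExpect IsRConnected)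
open Summit.QuantumFields.YangMills.Cruxes.IR.Tempered (cellEdges windowCells regionEdges collarEdges)
open Summit.QuantumFields.YangMills.Cruxes.IR.ShellTempered (windowCellsPlus)
open Summit.QuantumFields.YangMills.Cruxes.IR.OnsetFormats (shellCount UnivShellCond)
open Summit.QuantumFields.YangMills.Cruxes.IR.FixedMesh (ClauseI)
open Summit.QuantumFields.YangMills.Cruxes.IR.AfPincerUc (ClauseIAll IsFrame)
open Summit.QuantumFields.YangMills.Cruxes.IR.CellTempered.Engine (shiftFrame)

namespace Summit.QuantumFields.YangMills.Cruxes.IR.BlockedActivity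

/-! ## §1 The LOCAL relativised representation and the local W-classes -/

section Defs

variable {G : Type} [Group G] [TopologicalSpace G] [IsTopologicalGroup G] [CompactSpace G]
  [MeasurableSpace G] [BorelSpace G]

/-- **Blocked local-perturbation representation relative to `S`, WITH finite range of the exterior dependence**: `BlockedRepOn` plus the
`local_g` axiom of `BlockedRep` (the factor of the cell `p` reads the exterior datum only on the cells adjacent to `p` outside `Y`). -/
structure BlockedRepOnLoc {N : ℕ} (ρ : G →* Matrix (Fin N) (Fin N) ℂ) (β : ℝ) (w : Fin 4 → ℤ → ℤ)
    (Y : Finset Cell) (a : ℝ) (S : Set (LGConfig 4 G)) extends BlockedRepOn ρ β w Y a S where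
  /-- finite range of the exterior dependence -/
  local_g : ∀ p, ∀ σ σ' : LGConfig 4 G,
    (∀ c, CellAdj c p → c ∉ Y → ∀ e ∈ cellEdges w c, σ e = σ' e) → g σ p = g σ' p

/-- **The LOCAL W-class**: as `BlockedActivityClassW` (window-indexed reference), with `local_g`. -/
def BlockedActivityClassWLoc {N : ℕ} (ρ : G →* Matrix (Fin N) (Fin N) ℂ) (β : ℝ) (b n : ℕ) (a : ℝ) : Prop :=
  ∀ w : Fin 4 → ℤ → ℤ, (∀ i j, w i j + ((b : ℕ) : ℤ) ≤ w i (j + 1) ∧ w i (j + 1) ≤ w i j + 2 * ((b : ℕ) : ℤ)) →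
    ∀ Y : Finset Cell, Y ⊆ windowCells n → (0 : Cell) ∈ Y →
      ∀ τ : LGConfig 4 G, Nonempty (BlockedRepOnLoc ρ β w Y a (WindowAgree w n Y τ))

/-- **The LOCAL W|Typ class at one frame.** -/
def BlockedActivityTypWLoc {N : ℕ} (ρ : G →* Matrix (Fin N) (Fin N) ℂ) (β : ℝ) (w : Fin 4 → ℤ → ℤ) (n : ℕ) (a : ℝ)
    (Typ : Cell → Set (LGConfig 4 G)) : Prop :=
  ∀ Y : Finset Cell, Y ⊆ windowCells n → (0 : Cell) ∈ Y →
    ∀ τ : LGConfig 4 G, Nonempty (BlockedRepOnLoc ρ β w Y a (WindowAgree w n Y τ ∩ TypicalOff n Y Typ))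

/-- … at every centre (shifted frames, re-indexed class). -/
def BlockedActivityTypWLocAll {N : ℕ} (ρ : G →* Matrix (Fin N) (Fin N) ℂ) (β : ℝ) (w : Fin 4 → ℤ → ℤ) (n : ℕ) (a : ℝ)
    (Typ : Cell → Set (LGConfig 4 G)) : Prop :=
  ∀ c₀ : Cell, BlockedActivityTypWLoc ρ β (shiftFrame w c₀) n a (fun c => Typ (c + c₀))

end Defs

section Transfers

variable {G : Type} [Group G] [TopologicalSpace G] [IsTopologicalGroup G] [CompactSpace G]
  [MeasurableSpace G] [BorelSpace G] {N : ℕ} {ρ : G →* Matrix (Fin N) (Fin N) ℂ} {β : ℝ}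
  {w : Fin 4 → ℤ → ℤ} {Y : Finset Cell} {a : ℝ} {n : ℕ} {S : Set (LGConfig 4 G)}

/-- A uniform representation (which HAS `local_g`) is a local representation relative to every `S`. -/
def blockedRepOnLoc_of_blockedRep (R : BlockedRep ρ β w Y a) (S : Set (LGConfig 4 G)) : BlockedRepOnLoc ρ β w Y a S where
  toBlockedRepOn := blockedRepOn_of_blockedRep R S
  local_g := R.local_g

/-- Restriction to a smaller set of data. -/
def BlockedRepOnLoc.mono {S S' : Set (LGConfig 4 G)} (R : BlockedRepOnLoc ρ β w Y a S) (h : S' ⊆ S) : BlockedRepOnLoc ρ β w Y a S' where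
  toBlockedRepOn := R.toBlockedRepOn.mono h
  local_g := R.local_g

/-- The σ-uniform class (p527934; it has `local_g`) implies the local W-class. -/
theorem blockedActivityClassWLoc_of_blockedActivityClass {b : ℕ} (hC : BlockedActivityClass ρ β b n a) :
    BlockedActivityClassWLoc ρ β b n a := fun w hw Y hY h0 _ => by
  obtain ⟨R⟩ := hC w hw Y hY h0
  exact ⟨blockedRepOnLoc_of_blockedRep R _⟩

/-- Forgetting `local_g`: the local W-class implies the W-class of record. -/
theorem blockedActivityClassW_of_blockedActivityClassWLoc {b : ℕ} (hC : BlockedActivityClassWLoc ρ β b n a) :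
    BlockedActivityClassW ρ β b n a := fun w hw Y hY h0 τ => by
  obtain ⟨R⟩ := hC w hw Y hY h0 τ
  exact ⟨R.toBlockedRepOn⟩

/-- Forgetting `local_g`, W|Typ. -/
theorem blockedActivityTypW_of_blockedActivityTypWLoc {Typ : Cell → Set (LGConfig 4 G)} (hC : BlockedActivityTypWLoc ρ β w n a Typ) :
    BlockedActivityTypW ρ β w n a Typ := fun Y hY h0 τ => by
  obtain ⟨R⟩ := hC Y hY h0 τ
  exact ⟨R.toBlockedRepOn⟩

/-- The local W-class gives the local W|Typ class at that frame, for every `Typ`. -/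
theorem blockedActivityTypWLoc_of_blockedActivityClassWLoc {b : ℕ} (hC : BlockedActivityClassWLoc ρ β b n a) (hw : IsFrame b w)
    (Typ : Cell → Set (LGConfig 4 G)) : BlockedActivityTypWLoc ρ β w n a Typ := fun Y hY h0 τ => by
  obtain ⟨R⟩ := hC w hw Y hY h0 τ
  exact ⟨R.mono Set.inter_subset_left⟩

/-- **Strong coupling inhabits the LOCAL W-class at every mesh** (the `b⁻⁴` threshold of `Theorems/IR/BlockedActivityCalibrationMesh`, p541588). -/
theorem blockedActivityClassWLoc_of_mesh_threshold {b : ℕ} (hρ : Continuous ρ) {C : ℝ}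
    (hC : ∀ (x : Fin 4 → ℤ) (i j : Fin 4) (U : LGConfig 4 G), |plaquetteObs ρ x i j U| ≤ C)
    (hb : 1 ≤ b) (ha2 : a ≤ 2) (hβ : (96 : ℝ) * (b : ℝ) ^ 4 * |β| * ((N : ℝ) + C) ≤ a / 2) (n : ℕ) :
    BlockedActivityClassWLoc ρ β b n a :=
  blockedActivityClassWLoc_of_blockedActivityClass (blockedActivityClass_of_mesh_threshold ρ β hρ hC hb ha2 hβ n)

end Transfers

/-! ## §2 Geometry: the cell sup-norm along chains of adjacent cells -/

section Geometry

/-- The sup-norm of a cell index (`ℕ`-valued). -/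
def cellSup (c : Cell) : ℕ := Finset.univ.sup fun i => (c i).natAbs

/-- `cellSup c ≤ k ↔ ∀ i, |c i| ≤ k`. -/
theorem cellSup_le_iff {c : Cell} {k : ℕ} : cellSup c ≤ k ↔ ∀ i, (c i).natAbs ≤ k := by
  unfold cellSup; rw [Finset.sup_le_iff]; simp

/-- Each coordinate is bounded by the sup-norm. -/
theorem natAbs_le_cellSup (c : Cell) (i : Fin 4) : (c i).natAbs ≤ cellSup c :=
  Finset.le_sup (f := fun i => (c i).natAbs) (Finset.mem_univ i)

/-- `cellSup 0 = 0`. -/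
theorem cellSup_zero : cellSup (0 : Cell) = 0 := by
  apply le_antisymm _ (Nat.zero_le _)
  exact cellSup_le_iff.2 fun i => by simp

/-- Adjacent cells have sup-norms differing by at most one. -/
theorem cellSup_le_succ_of_cellAdj {c c' : Cell} (h : CellAdj c c') : cellSup c' ≤ cellSup c + 1 := by
  refine cellSup_le_iff.2 fun i => ?_
  obtain ⟨h1a, h1b⟩ := abs_le.1 (h i)
  have h2 := natAbs_le_cellSup c i
  omega

/-- The window of radius `2n` in terms of the sup-norm. -/
theorem mem_windowCells_iff_cellSup {n : ℕ} {c : Cell} : c ∈ windowCells n ↔ cellSup c ≤ 2 * n := by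
  unfold Summit.QuantumFields.YangMills.Cruxes.IR.Tempered.windowCells
  rw [Fintype.mem_piFinset, cellSup_le_iff]
  refine forall_congr' fun i => ?_
  rw [Finset.mem_Icc]
  omega

/-- **Discrete intermediate values**: along a `CellAdj`-connected set, every sup-norm value between those of two members is attained. -/
theorem exists_mem_cellSup_eq {A : Finset Cell} (hA : IsRConnected CellAdj A) {q p : Cell} (hq : q ∈ A) (hp : p ∈ A)
    {k : ℕ} (hqk : cellSup q ≤ k) (hkp : k ≤ cellSup p) : ∃ c ∈ A, cellSup c = k := by
  have hpath := hA.2 q hq p hp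
  -- invariant: every value in `[cellSup q, cellSup x]` is attained, for `x` reachable from `q`
  have key : ∀ x, Relation.ReflTransGen (fun x y => CellAdj x y ∧ x ∈ A ∧ y ∈ A) q x →
      ∀ k, cellSup q ≤ k → k ≤ cellSup x → ∃ c ∈ A, cellSup c = k := by
    intro x hx
    induction hx with
    | refl => exact fun k h1 h2 => ⟨q, hq, le_antisymm (by omega) (by omega)⟩
    | @tail b y _ hby ih =>
      intro k h1 h2
      obtain ⟨hadj, -, hyA⟩ := hby
      by_cases hk : k ≤ cellSup b
      · exact ih k h1 hk
      · have := cellSup_le_succ_of_cellAdj hadj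
        exact ⟨y, hyA, by omega⟩
  exact key p hpath k hqk hkp

/-- **A `CellAdj`-connected cell set joining a neighbour of the centre to sup-norm `≥ 2n` has at least `2n` cells.** -/
theorem two_mul_le_card_of_connected {A : Finset Cell} (hA : IsRConnected CellAdj A) {q p : Cell} (hq : q ∈ A)
    (hq1 : cellSup q ≤ 1) (hp : p ∈ A) {n : ℕ} (hpn : 2 * n ≤ cellSup p) : 2 * n ≤ A.card := by
  classical
  -- for each `k ∈ [1, 2n]` choose a cell of `A` with sup-norm `k`
  have hex : ∀ k ∈ Finset.Icc 1 (2 * n), ∃ c ∈ A, cellSup c = k := fun k hk => by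
    rw [Finset.mem_Icc] at hk
    exact exists_mem_cellSup_eq hA hq hp (by omega) (by omega)
  choose! φ hφA hφk using hex
  have hinj : Set.InjOn φ (Finset.Icc 1 (2 * n) : Finset ℕ) := fun k hk k' hk' h => by
    have h1 := hφk k hk; have h2 := hφk k' hk'
    rw [h] at h1; rw [h1] at h2; exact h2
  calc 2 * n = (Finset.Icc 1 (2 * n)).card := by simp
    _ ≤ A.card := Finset.card_le_card_of_injOn φ (fun k hk => hφA k hk) hinj

end Geometry

/-! ## §3 The distance-sensitive reduction -/

section Reduction

variable {G : Type} [Group G] [TopologicalSpace G] [IsTopologicalGroup G] [CompactSpace G]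
  [MeasurableSpace G] [BorelSpace G] {N : ℕ} {ρ : G →* Matrix (Fin N) (Fin N) ℂ} {β : ℝ}
  {w : Fin 4 → ℤ → ℤ} {Y : Finset Cell} {a ε τ : ℝ} {n : ℕ} {S : Set (LGConfig 4 G)}

/-- **The Kotecký–Preiss step, DISTANCE-SENSITIVE**: for a local representation relative to `S` with `e^{1+τ} a 83² ≤ 1∕2` (`τ ≥ 0`), two
data `σ, σ' ∈ S` agreeing on the window cells off `Y` move the centre-cell kernel expectation by at most `664 e^{2+τ} e^{−τ(2n+1)}`:
their cell factors differ only at cell-sup-norm `≥ 2n` (`local_g`), every `CellAdj`-chain from the centre's neighbours to there has `≥ 2n`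
cells, and `KP.norm_pertExpect_sub_pertExpect_le_of_eqOn` (`Δ = 81`, `Δ' = 82`, `S = {0}`, `B = 1`, `m = 2n`) applies. -/
theorem BlockedRepOnLoc.abs_integral_sub_integral_le_decay (R : BlockedRepOnLoc ρ β w Y a S) (hτ : 0 ≤ τ)
    (hsmall : Real.exp (1 + τ) * a * 83 ^ 2 ≤ 1 / 2) {σ σ' : LGConfig 4 G} (hσ : σ ∈ S) (hσ' : σ' ∈ S)
    (hagree : ∀ c ∈ windowCellsPlus n, c ∉ Y → c ∈ windowCells n → ∀ e ∈ cellEdges w c, σ e = σ' e)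
    {f : LGConfig 4 G → ℝ} (hf : IsCentreObs w f) :
    |(∫ U, f U ∂(ymSpecification ρ β (regionEdges w Y) σ)) - ∫ U, f U ∂(ymSpecification ρ β (regionEdges w Y) σ')| ≤
      664 * Real.exp (2 + τ) * Real.exp (-(τ * (2 * (n : ℝ) + 1))) := by
  classical
  letI := R.mΩ
  haveI := R.isProb
  -- the far cells: sup-norm `≥ 2n`
  set D : Finset Cell := R.C.filter fun p => 2 * n ≤ cellSup p with hD
  -- the factors agree off `D`
  have heq : ∀ p ∈ R.C, p ∉ D → R.g σ p = R.g σ' p := by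
    intro p hpC hpD
    have hp : cellSup p < 2 * n := by
      by_contra hge; exact hpD (Finset.mem_filter.2 ⟨hpC, not_lt.1 hge⟩)
    refine R.local_g p σ σ' fun c hcp hcY e he => ?_
    have hc : c ∈ windowCells n := by
      rw [mem_windowCells_iff_cellSup]
      have := cellSup_le_succ_of_cellAdj (cellAdj_symm _ _ hcp)
      omega
    exact hagree c (AfPincerUc.Calibration.windowCells_subset_windowCellsPlus n hc) hcY hc e he
  -- the distance hypothesis
  have hfar : ∀ A : Finset Cell, A ⊆ R.C → IsRConnected CellAdj A →
      (∃ q ∈ A, q ∈ ({0} : Finset Cell) ∨ ∃ w' ∈ ({0} : Finset Cell), CellAdj w' q) → (∃ d ∈ A, d ∈ D) → 2 * n ≤ A.card := by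
    rintro A - hA ⟨q, hqA, hq⟩ ⟨d, hdA, hdD⟩
    have hq1 : cellSup q ≤ 1 := by
      rcases hq with hq | ⟨w', hw', hwq⟩
      · rw [Finset.mem_singleton] at hq; subst hq; rw [cellSup_zero]; exact Nat.zero_le _
      · rw [Finset.mem_singleton] at hw'; subst hw'
        have := cellSup_le_succ_of_cellAdj hwq
        rw [cellSup_zero] at this; omega
    exact two_mul_le_card_of_connected hA hqA hq1 hdA (Finset.mem_filter.1 hdD).2
  have hsmall' : Real.exp (1 + τ) * a * (((82 : ℕ) : ℝ) + 1) ^ 2 ≤ 1 / 2 := by norm_num at hsmall ⊢; exact hsmall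
  have h := KP.norm_pertExpect_sub_pertExpect_le_of_eqOn (R := CellAdj) (nbr := cellNbr) (Δ := 81) (Δ' := 82) (m := 2 * n)
    cellAdj_symm card_cellNbr_le mem_cellNbr_of_cellAdj (by norm_num) (by simp)
    (R.perturbation σ hσ) (R.perturbation σ' hσ') (R.obs_local f hf) one_pos hτ hsmall' hfar heq
  rw [← R.rep σ hσ f hf, ← R.rep σ' hσ' f hf, ← Complex.ofReal_sub, Complex.norm_real, Real.norm_eq_abs] at h
  refine h.trans (le_of_eq ?_)
  push_cast
  ring

/-- **LOCAL W-reduction, distance-sensitive**: `BlockedActivityClassWLoc ρ β b n a`, `τ ≥ 0`, `e^{1+τ} a 83² ≤ 1∕2` and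
`664 e^{2+τ} e^{−τ(2n+1)} ≤ ε` give `OnsetFormats.UnivShellCond ρ β b n ε`.  The radius condition does not involve `ε`. -/
theorem univShellCond_of_blockedActivityWLoc_decay {b : ℕ} (hC : BlockedActivityClassWLoc ρ β b n a) (hτ : 0 ≤ τ)
    (hsmall : Real.exp (1 + τ) * a * 83 ^ 2 ≤ 1 / 2)
    (hε : 664 * Real.exp (2 + τ) * Real.exp (-(τ * (2 * (n : ℝ) + 1))) ≤ ε) : UnivShellCond ρ β b n ε := by
  intro w hw Y hY h0 σ σ' hagree f hf hfm hf01
  obtain ⟨R⟩ := hC w hw Y hY h0 σ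
  exact (R.abs_integral_sub_integral_le_decay hτ hsmall (mem_windowAgree_self σ) (mem_windowAgree_of_agree hagree) hagree
    ⟨hf, hfm, hf01⟩).trans hε

/-- **LOCAL W|Typ-reduction, distance-sensitive**: `BlockedActivityTypWLoc ρ β w n a Typ → … → FixedMesh.ClauseI ρ β w n ε Typ`. -/
theorem clauseI_of_blockedActivityTypWLoc_decay {Typ : Cell → Set (LGConfig 4 G)} (hC : BlockedActivityTypWLoc ρ β w n a Typ)
    (hτ : 0 ≤ τ) (hsmall : Real.exp (1 + τ) * a * 83 ^ 2 ≤ 1 / 2)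
    (hε : 664 * Real.exp (2 + τ) * Real.exp (-(τ * (2 * (n : ℝ) + 1))) ≤ ε) : ClauseI ρ β w n ε Typ := by
  intro Y hY h0 σ σ' htyp hagree f hf hfm hf01
  obtain ⟨R⟩ := hC Y hY h0 σ
  have hσ : σ ∈ WindowAgree w n Y σ ∩ TypicalOff n Y Typ := ⟨mem_windowAgree_self σ, fun c hc hcY => (htyp c hc hcY).1⟩
  have hσ' : σ' ∈ WindowAgree w n Y σ ∩ TypicalOff n Y Typ := ⟨mem_windowAgree_of_agree hagree, fun c hc hcY => (htyp c hc hcY).2⟩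
  exact (R.abs_integral_sub_integral_le_decay hτ hsmall hσ hσ' hagree ⟨hf, hfm, hf01⟩).trans hε

/-- … at every centre (the `hadapt` shape of cplan (6d), distance-sensitive). -/
theorem clauseIAll_of_blockedActivityTypWLocAll_decay {Typ : Cell → Set (LGConfig 4 G)} (hC : BlockedActivityTypWLocAll ρ β w n a Typ)
    (hτ : 0 ≤ τ) (hsmall : Real.exp (1 + τ) * a * 83 ^ 2 ≤ 1 / 2)
    (hε : 664 * Real.exp (2 + τ) * Real.exp (-(τ * (2 * (n : ℝ) + 1))) ≤ ε) : ClauseIAll ρ β w n ε Typ :=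
  fun c₀ => clauseI_of_blockedActivityTypWLoc_decay (hC c₀) hτ hsmall hε

end Reduction

/-! ## §4 THE NUMBERS: the KP hand-over radius `r_C` and the window law `w(ε)` (owner R118 (3)) -/

section Numbers

/-- **The hand-over radius of the decay reduction**: `radiusDecay τ = 1 ∕ (2 e^{1+τ} · 83²)` — the plain Kotecký–Preiss radius of the
`Δ' = 82` extended cell system with decay room `τ`; independent of the accuracy `ε`. -/
def radiusDecay (τ : ℝ) : ℝ := 1 / (2 * Real.exp (1 + τ) * 83 ^ 2)

/-- **The accuracy bought by the window**: `decayBound τ n = 664 e^{2+τ} e^{−τ(2n+1)}`.  `decayBound τ n ≤ ε` iff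
`n ≥ (log (664∕ε) + 2 + τ) ∕ (2τ) − 1∕2`; at `τ = 1`: `w(ε) = ⌈½ ln(1∕ε) + 4.25⌉` (`ln 664 ≈ 6.50`). -/
def decayBound (τ : ℝ) (n : ℕ) : ℝ := 664 * Real.exp (2 + τ) * Real.exp (-(τ * (2 * (n : ℝ) + 1)))

/-- `radiusDecay τ > 0`. -/
theorem radiusDecay_pos (τ : ℝ) : 0 < radiusDecay τ := by unfold radiusDecay; positivity

/-- `a ≤ radiusDecay τ` is exactly the smallness hypothesis of the decay reduction (for `a ≥ 0`). -/
theorem smallness_of_le_radiusDecay {a τ : ℝ} (ha : a ≤ radiusDecay τ) : Real.exp (1 + τ) * a * 83 ^ 2 ≤ 1 / 2 := by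
  unfold radiusDecay at ha
  have hpos : 0 < 2 * Real.exp (1 + τ) * 83 ^ 2 := by positivity
  have := (le_div_iff₀ hpos).1 ha
  nlinarith [Real.exp_pos (1 + τ)]

/-- **Certified enclosure of `r_C`**: `1∕101810 < radiusDecay 1 < 1∕101800` (`2 · e² · 6889`, `e² ∈ (7.38905, 7.38906)`), i.e.
`r_C ≈ 9.82·10⁻⁶` per mesh-`b` cell — against `radiusKP (1∕3552) ∈ (2.81, 2.88)·10⁻⁹` (`radiusKP_bounds`, p534919): a factor `≈ 3.4·10³`. -/
theorem radiusDecay_one_bounds : 1 / 101810 < radiusDecay 1 ∧ radiusDecay 1 < 1 / 101800 := by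
  have h1 := Real.exp_one_gt_d9
  have h2 := Real.exp_one_lt_d9
  have he2 : Real.exp (1 + 1) = Real.exp 1 * Real.exp 1 := by rw [Real.exp_add]
  unfold radiusDecay
  rw [he2]
  constructor
  · rw [div_lt_div_iff₀ (by norm_num) (by positivity)]
    nlinarith
  · rw [div_lt_div_iff₀ (by positivity) (by norm_num)]
    nlinarith

/-- `shellCount 12 = 51⁴ − 49⁴ = 1000400`. -/
theorem shellCount_twelve : shellCount 12 = 1000400 := by
  unfold Summit.QuantumFields.YangMills.Cruxes.IR.OnsetFormats.shellCount; norm_num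

/-- **Window `n = 12` is ADMISSIBLE at `τ = 1`**: `decayBound 1 12 · shellCount 12 ≤ 3∕4`
(`664 · e^{−22} · 1000400 ≈ 0.185`; certified through `e > 2.718281828`, `2.718281828²² > 3.5·10⁹`). -/
theorem decayBound_one_twelve_admissible : decayBound 1 12 * shellCount 12 ≤ 3 / 4 := by
  rw [shellCount_twelve]
  unfold decayBound
  have h1 := Real.exp_one_gt_d9
  have hexp : Real.exp (2 + 1) * Real.exp (-(1 * (2 * ((12 : ℕ) : ℝ) + 1))) = (Real.exp 22)⁻¹ := by
    rw [← Real.exp_add, ← Real.exp_neg]; norm_num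
  rw [mul_assoc 664, hexp]
  have h22 : (3500000000 : ℝ) < Real.exp 22 := by
    have : Real.exp 22 = Real.exp 1 ^ 22 := by rw [Real.exp_one_pow 22]; norm_num
    rw [this]
    calc (3500000000 : ℝ) < (2.718281828 : ℝ) ^ 22 := by norm_num
      _ < Real.exp 1 ^ 22 := pow_lt_pow_left₀ (by linarith) (by norm_num) (by norm_num : (22 : ℕ) ≠ 0)
  have hpos : 0 < Real.exp 22 := Real.exp_pos 22
  rw [← div_eq_mul_inv, div_mul_eq_mul_div, div_le_iff₀ hpos]
  nlinarith

/-- `(12, decayBound 1 12)` is an admissible pair of the onset formats: `1 ≤ 12`, `0 ≤ ε`, `ε · shellCount 12 ≤ 3∕4`. -/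
theorem admissible_twelve : (1 : ℕ) ≤ 12 ∧ 0 ≤ decayBound 1 12 ∧ decayBound 1 12 * shellCount 12 ≤ 3 / 4 :=
  ⟨by norm_num, by unfold decayBound; positivity, decayBound_one_twelve_admissible⟩

variable {G : Type} [Group G] [TopologicalSpace G] [IsTopologicalGroup G] [CompactSpace G]
  [MeasurableSpace G] [BorelSpace G] {N : ℕ} {ρ : G →* Matrix (Fin N) (Fin N) ℂ} {β a : ℝ}

/-- **THE NUMBER of the decay reduction** (owner R118 (3)): at window `n = 12`, per-cell activity `a ≤ r_C = radiusDecay 1 ≈ 9.82·10⁻⁶`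
in the LOCAL W-class gives `UnivShellCond ρ β b 12 (decayBound 1 12)` — an ADMISSIBLE accuracy (`admissible_twelve`). -/
theorem univShellCond_twelve_of_blockedActivityWLoc {b : ℕ} (hC : BlockedActivityClassWLoc ρ β b 12 a) (ha : a ≤ radiusDecay 1) :
    UnivShellCond ρ β b 12 (decayBound 1 12) :=
  univShellCond_of_blockedActivityWLoc_decay hC zero_le_one (smallness_of_le_radiusDecay ha) le_rfl

/-- The general form with the named constants: `a ≤ radiusDecay τ`, `decayBound τ n ≤ ε` ⇒ `UnivShellCond ρ β b n ε`. -/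
theorem univShellCond_of_blockedActivityWLoc_radiusDecay {b n : ℕ} {τ ε : ℝ} (hC : BlockedActivityClassWLoc ρ β b n a) (hτ : 0 ≤ τ)
    (ha : a ≤ radiusDecay τ) (hε : decayBound τ n ≤ ε) : UnivShellCond ρ β b n ε :=
  univShellCond_of_blockedActivityWLoc_decay hC hτ (smallness_of_le_radiusDecay ha) hε

/-- The W|Typ form with the named constants, at every centre. -/
theorem clauseIAll_of_blockedActivityTypWLocAll_radiusDecay {w : Fin 4 → ℤ → ℤ} {n : ℕ} {τ ε : ℝ}
    {Typ : Cell → Set (LGConfig 4 G)} (hC : BlockedActivityTypWLocAll ρ β w n a Typ) (hτ : 0 ≤ τ)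
    (ha : a ≤ radiusDecay τ) (hε : decayBound τ n ≤ ε) : ClauseIAll ρ β w n ε Typ :=
  clauseIAll_of_blockedActivityTypWLocAll_decay hC hτ (smallness_of_le_radiusDecay ha) hε

/-- **Strong side meets the decay radius at every mesh**: for `|plaquetteObs ρ| ≤ C` and `96 b⁴ |β| (N + C) ≤ radiusDecay 1 ∕ 2`, the
Wilson kernels are in the local W-class at radius `radiusDecay 1`, hence `UnivShellCond ρ β b 12 (decayBound 1 12)` (both ends of the
activity axis in ONE currency with ONE explicit radius and ONE admissible window). -/
theorem univShellCond_twelve_of_mesh_threshold {b : ℕ} (hρ : Continuous ρ) {C : ℝ}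
    (hC : ∀ (x : Fin 4 → ℤ) (i j : Fin 4) (U : LGConfig 4 G), |plaquetteObs ρ x i j U| ≤ C)
    (hb : 1 ≤ b) (hβ : (96 : ℝ) * (b : ℝ) ^ 4 * |β| * ((N : ℝ) + C) ≤ radiusDecay 1 / 2) :
    UnivShellCond ρ β b 12 (decayBound 1 12) := by
  have hr2 : radiusDecay 1 ≤ 2 := by
    have := radiusDecay_one_bounds.2; linarith
  exact univShellCond_twelve_of_blockedActivityWLoc (blockedActivityClassWLoc_of_mesh_threshold hρ hC hb hr2 hβ 12) le_rfl

end Numbers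

end Summit.QuantumFields.YangMills.Cruxes.IR.BlockedActivity

end
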